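import Summits.AnomalousDissipation.AnomalousDissipation.Theorems.SolenoidalFractalHomogenisationLagrangianStepVmodLossAdjOnsetDiag
import Literature.Analysis.FluidPDE.PassiveVectorTensorGardingDivergence
import HarnessLib

/-!
# K1L_D (stmt-AnomalousDissipation-27980), (ℓ3-A) road A, (S2-adj) glue: the onset bound in GRADIENT currency —
# `c(lo,h,η,θ)·‖∇(J(t₀−σ)•φ₀)‖₂² − σ·N·‖g_σ‖₂ ≤ D(σ)` (diagonal onset bound p732954 ∘ twisted Gårding E2′ §5)
(helper; `--supports 27980 --as helper`; prover ad-k1loc-p3 g12.)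

CONVENTION (D28-8′): derivative-index distortion `Torus.Visc4.conj`; constraint `∇·(G v) = 0`.

The diagonal onset bound (p732954 `EnergyDuhamelG.exists_adjWitness_onsetDiag`) controls the adjoint dissipation density of the coarse member from below by
the twisted energy form `Q_σ(χ_σ) = ∫ E_{(𝔸Tᵀ)^{G(t₀−σ)}}(∇χ_σ)` of the co-moving corrected test `χ_σ = J(t₀−σ)•φ₀`.  Since `χ_σ` is smooth and
`G(t₀−σ)`-solenoidal, the SMOOTH twisted Gårding inequality of `PassiveVectorTensorGardingDivergence` (E2′ §5,
`Torus.integral_inner_viscAdjVar_conj_self_le_of_isDivFree_distort`, with the energy-form identity `integral_inner_viscAdjVar_self_eq_neg_gradForm`)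
gives `Q_σ(χ_σ) ≥ c·‖∇χ_σ‖₂²`, `c = lo − η − (lo − η + h + h²/η)(3θ)² − h(6θ + 9θ²)`, for `NearIso 𝔸T lo hi`, `FullBound 𝔸T h` (a DEVICE
hypothesis to be supplied after T♮-canonicalisation, D28-8‴ — no text carries it), `0 < η ≤ lo`, `|G − 1| ≤ θ` (the class `IsFrameModulation θ …`).
* `integral_quadForm_conj_ge_gradNormSq` — the twisted Gårding floor in the `EnergyIdG(Adj)` summation order;
* **`EnergyDuhamelG.exists_adjWitness_onsetGarding`** — for a.e. `σ ∈ (0,t₀)`: `c·gradNormSq (J(t₀−σ)•φ₀) − σ·N·‖g_σ‖_{L²} ≤ D(σ)`.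
What remains for the (S2-adj) short row: `gradNormSq (J•φ₀)` versus `gradNormSq φ₀` for a slow band, the size of `N·‖g_σ‖` (F-p3g12-1), and the time
integration (`two_setIntegral_le_of_le_density`, p730365).  `sorry`-free; NOT a proof of any block, of K1L_D or of AD; rung F-D1.A0.
-/

set_option linter.dupNamespace false

noncomputable section

namespace Summit.AnomalousDissipation.AnomalousDissipation.Theorems.SolenoidalFractalHomogenisation.LagrangianStep.VmodDist

open Literature.Analysis Literature.Analysis.FluidPDE Literature.Analysis.FunctionSpaces
open MeasureTheory Set Filter Function
open scoped ENNReal NNReal InnerProductSpace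
open Summit.AnomalousDissipation.AnomalousDissipation.Theorems.SolenoidalFractalHomogenisation.LagrangianStep.CellClauseMod
open Summit.AnomalousDissipation.AnomalousDissipation.Theorems.SolenoidalFractalHomogenisation.LagrangianStep.CellEnergyT

/-! ## §1 The twisted Gårding floor in the energy-identity summation order -/

/-- **Twisted Gårding floor for the `EnergyIdG(Adj)` integrand**: for a smooth `G`-solenoidal `χ`, a frame `Gs` with smooth entries, Piola columns and
`|Gs − 1| ≤ θ`, and a tensor `𝔸'` with `NearIso 𝔸' lo hi`, `FullBound 𝔸' h`, `0 < η ≤ lo`: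
`c·gradNormSq χ ≤ ∫ Σ_{l,i,c,e} (𝔸')^{Gs}_{icle} (∂_cχ)_i (∂_eχ)_l`, `c = lo − η − (lo − η + h + h²/η)(3θ)² − h(2·3θ + (3θ)²)`. -/
theorem integral_quadForm_conj_ge_gradNormSq {𝔸' : Torus.Visc4 (Fin 3)} {lo hi h η θ : ℝ}
    (h𝔸 : Torus.NearIso 𝔸' lo hi) (hB : Torus.FullBound 𝔸' h) (hh : 0 ≤ h) (hη : 0 < η) (hηlo : η ≤ lo)
    {Gs : UnitAddTorus (Fin 3) → Matrix (Fin 3) (Fin 3) ℝ} (hGs : ∀ c a, Torus.IsSmooth (fun y => Gs y c a))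
    (hGp : ∀ a, Torus.IsDivFree (fun y => (WithLp.toLp 2 fun c => Gs y c a : EuclideanSpace ℝ (Fin 3))))
    (hθ : 0 ≤ θ) (hG1 : ∀ y c a, |Gs y c a - (1 : Matrix (Fin 3) (Fin 3) ℝ) c a| ≤ θ)
    {χ : VF} (hχ : Torus.IsSmooth χ) (hdiv : Torus.IsDivFree (Torus.distort Gs χ)) :
    (lo - η - (lo - η + h + h ^ 2 / η) * (3 * θ) ^ 2 - h * (2 * (3 * θ) + (3 * θ) ^ 2)) * Torus.gradNormSq χ
      ≤ ∫ x, ∑ l, ∑ i, ∑ c, ∑ e, Torus.Visc4.conj (Gs x) 𝔸' i c l e * (Torus.partialDeriv c χ x) i * (Torus.partialDeriv e χ x) l := by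
  have key := Torus.integral_inner_viscAdjVar_conj_self_le_of_isDivFree_distort h𝔸 hB hh hη hηlo hGs hGp hχ hdiv hθ hG1
  rw [Torus.integral_inner_viscAdjVar_self_eq_neg_gradForm (fun i c j e => Torus.isSmooth_conj_entry hGs 𝔸' i c j e) hχ] at key
  have e : ∫ x, ∑ l, ∑ i, ∑ c, ∑ e, Torus.Visc4.conj (Gs x) 𝔸' i c l e * (Torus.partialDeriv c χ x) i * (Torus.partialDeriv e χ x) l
      = ∫ x, Torus.gradForm (Torus.Visc4.conj (Gs x) 𝔸') (fun i c => (Torus.partialDeriv c χ x) i) :=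
    integral_congr_ae (Eventually.of_forall fun x => quadForm_eq_gradForm _ _)
  rw [e]
  have hcard : (Fintype.card (Fin 3) : ℝ) = 3 := by simp
  rw [hcard] at key
  linarith

/-! ## §2 The onset bound in gradient currency -/

variable {Tw θ nC : ℝ} {𝔸U 𝔸T : Torus.Visc4 (Fin 3)} {bU : ℝ → VF} {G J J' : ℝ → UnitAddTorus (Fin 3) → Matrix (Fin 3) (Fin 3) ℝ}
  {U T : ℝ → ℝ → (V2 →L[ℝ] V2)} {φ₀ : VF}

set_option maxHeartbeats 800000 in
/-- **(S2-adj) ONSET BOUND IN GRADIENT CURRENCY.**  Under the hypotheses of `EnergyDuhamelG.exists_adjWitness_onsetDiag` (p732954) and, for the coarse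
tensor, `NearIso 𝔸T lo hi`, `FullBound 𝔸T h` (device hypothesis), `0 < η ≤ lo`: the pinned adjoint witness `(Ψ, DΨ)` at `ζ = [J(t₀)•φ₀]`, its clauses
and loss formula, and for a.e. `σ ∈ (0,t₀)`
`c·gradNormSq (J(t₀−σ)•φ₀) − σ·N·‖g_σ‖_{L²} ≤ D(σ)`,  `c = lo − η − (lo − η + h + h²/η)(3θ)² − h(6θ + 9θ²)`. -/
theorem EnergyDuhamelG.exists_adjWitness_onsetGarding (hED : EnergyDuhamelG Tw 𝔸U 𝔸T bU G U T)
    (hT : IsDistortedPropagator Tw 𝔸T (fun _ _ => 0) G T) (hG : IsFrameModulation θ Tw nC G) (hR : IsFrameRegular θ Tw nC G J)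
    (hsolT : ∀ s, 0 ≤ s → s < Tw → ∀ (φ : VF) (hφ : MemLp φ 2 volume), Torus.IsWeaklyDivFree (Torus.distort (G s) φ) → ∃ w : ℝ → VF,
      Torus.IsWeakTensorPassiveVectorDistortedOn 0 (Tw - s) 𝔸T (fun _ _ => 0) (fun τ => G (s + τ)) φ w)
    (hQ : ∀ ξ : Fin 3 → Fin 3 → ℝ, 0 ≤ ∑ l, ∑ i, ∑ c, ∑ e, 𝔸T i c l e * ξ c i * ξ e l)
    {lo hi h η : ℝ} (h𝔸 : Torus.NearIso 𝔸T lo hi) (hB : Torus.FullBound 𝔸T h) (hh : 0 ≤ h) (hη : 0 < η) (hηlo : η ≤ lo)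
    (hφs : Torus.IsSmooth φ₀) (hφdiv : Torus.IsDivFree φ₀)
    (hJ' : ∀ᵐ t ∂(volume.restrict (Ioo 0 Tw)), ∀ y, HasDerivAt (fun s => J s y) (J' t y) t)
    {N : ℝ} (hN0 : 0 ≤ N)
    (hN : ∀ᵐ τ ∂(volume.restrict (Ioo 0 Tw)),
      MemLp (fun x => Torus.distort (J' τ) φ₀ x + Torus.convect (fun _ => 0) (Torus.distort (J τ) φ₀) x +
          Torus.viscAdjVar (fun y => Torus.Visc4.conj (G τ y) 𝔸T) (Torus.distort (J τ) φ₀) x) 2 volume ∧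
      eLpNorm (fun x => Torus.distort (J' τ) φ₀ x + Torus.convect (fun _ => 0) (Torus.distort (J τ) φ₀) x +
          Torus.viscAdjVar (fun y => Torus.Visc4.conj (G τ y) 𝔸T) (Torus.distort (J τ) φ₀) x) 2 volume ≤ ENNReal.ofReal N)
    {t₀ : ℝ} (ht₀ : 0 < t₀) (ht₀T : t₀ ≤ Tw) :
    ∃ (Ψ : ℝ → VF) (DΨ : ℝ → Fin 3 → VF),
      Torus.IsWeakTensorPassiveVectorDistortedOn 0 t₀ (Torus.majorTranspose 𝔸T) (revCarrier (fun _ _ => 0) t₀) (fun σ => G (t₀ - σ))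
        (((((Torus.isSmooth_distort (hR.smooth t₀) hφs).memLp 2).toLp (Torus.distort (J t₀) φ₀) : V2) : V2) : VF) Ψ ∧
      (∀ c, MemLp (uncurry (DΨ · c)) 2 (((volume : Measure ℝ).restrict (Ioo 0 t₀)).prod volume)) ∧
      (∀ᵐ σ ∂(volume.restrict (Ioo 0 t₀)), ∀ c, Torus.HasWeakPartialDeriv c (Ψ σ) (DΨ σ c)) ∧
      (∀ s ∈ Ico 0 t₀, lossAdj (T s t₀) (((Torus.isSmooth_distort (hR.smooth t₀) hφs).memLp 2).toLp (Torus.distort (J t₀) φ₀)) =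
        2 * ∫ σ in Ioc 0 (t₀ - s), ∫ x, ∑ l, ∑ i, ∑ c, ∑ e,
          Torus.Visc4.conj (G (t₀ - σ) x) (Torus.majorTranspose 𝔸T) i c l e * (DΨ σ c x) i * (DΨ σ e x) l) ∧
      ∀ᵐ σ ∂(volume.restrict (Ioo 0 t₀)),
        (lo - η - (lo - η + h + h ^ 2 / η) * (3 * θ) ^ 2 - h * (2 * (3 * θ) + (3 * θ) ^ 2))
            * Torus.gradNormSq (Torus.distort (J (t₀ - σ)) φ₀)
          - σ * N * (eLpNorm (fun x => Torus.viscAdjVar (fun y => Torus.Visc4.conj (G (t₀ - σ) y) 𝔸T) (Torus.distort (J (t₀ - σ)) φ₀) x +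
              Torus.viscAdjVar (fun y => Torus.Visc4.conj (G (t₀ - σ) y) (Torus.majorTranspose 𝔸T)) (Torus.distort (J (t₀ - σ)) φ₀) x)
              2 volume).toReal
          ≤ ∫ x, ∑ l, ∑ i, ∑ c, ∑ e,
              Torus.Visc4.conj (G (t₀ - σ) x) (Torus.majorTranspose 𝔸T) i c l e * (DΨ σ c x) i * (DΨ σ e x) l := by
  have hTw : 0 ≤ Tw := ht₀.le.trans ht₀T
  have hθ0 : 0 ≤ θ := le_trans (abs_nonneg _) (hG.near_one 0 ⟨le_rfl, hTw⟩ 0 0 0)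
  obtain ⟨Ψ, DΨ, hcl, hM, hD, hloss, hae⟩ := hED.exists_adjWitness_onsetDiag hT hG hR hsolT hQ hφs hφdiv hJ' hN0 hN ht₀ ht₀T
  refine ⟨Ψ, DΨ, hcl, hM, hD, hloss, ?_⟩
  filter_upwards [hae, ae_restrict_mem measurableSet_Ioo] with σ hσ hσm
  have hmem : t₀ - σ ∈ Icc 0 Tw := ⟨by linarith [hσm.2], by linarith [hσm.1]⟩
  have h𝔸t : Torus.NearIso (Torus.majorTranspose 𝔸T) lo hi := (Torus.nearIso_majorTranspose_iff 𝔸T lo hi).2 h𝔸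
  have hBt : Torus.FullBound (Torus.majorTranspose 𝔸T) h := Torus.fullBound_majorTranspose hB
  have hfloor := integral_quadForm_conj_ge_gradNormSq h𝔸t hBt hh hη hηlo (Gs := G (t₀ - σ))
    (fun c a => hG.smooth _ hmem c a) (fun a => hG.piola _ hmem a) hθ0 (fun y c a => hG.near_one _ hmem y c a)
    (Torus.isSmooth_distort (hR.smooth (t₀ - σ)) hφs) (correctedTest_isDivFree hR.mul_eq_one hφdiv (t₀ - σ))
  linarith

end Summit.AnomalousDissipation.AnomalousDissipation.Theorems.SolenoidalFractalHomogenisation.LagrangianStep.VmodDist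

end
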